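import Summits.CriticalPhenomena.PercolationContinuityZ3.Theorems.PercNearOneGluingNoHeavyLowerTailSunflowerSpectatorRows
import Summits.CriticalPhenomena.PercolationContinuityZ3.Theorems.PercNearOneGluingNoHeavyLowerTailSunflowerPartitionReduction
import HarnessLib

/-!
# `NoHeavyLowerTail` (crux stmt-CriticalPhenomena-4575), abstract sunflower cubic: the partition lemma (all three rows `H, G, T`) HOLDS for every
# sunflower with two CROSS-INTERSECTING petals — in particular for the θ-pullback of three up-sets two of which are cross-intersecting

Support file (seat `prim-ineq-prove-1` gen 27; `--supports stmt-CriticalPhenomena-4575`; after `…SunflowerSpectatorRows` (p219831) and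
`…SunflowerPartitionReduction` (p217435)).  No `sorry`, no named facts, nothing asserted about the crux.
Memo: run/shared/lean/prim/prim-ineq-prove-1/SPECTATOR-ROWS-prove1-g27.md.

By `Sunflower.ZH_eq_spec` (`ZH = 3·Sw 1_{0,4} − Ntri`, spectator sums `≥ 0` by antipodal Gladkov) the rainbow tri-petal partitions are the ONLY negative
contribution to the partition functional.  A rainbow ordered 3-partition has three pairwise DISJOINT blocks lying in the three petals; so it cannot exist
as soon as two petals `C_i, C_j` are CROSS-INTERSECTING (every member of `C_i` meets every member of `C_j`):
* `Sunflower.Ntri_eq_zero_of_crossIntersecting`, `Sunflower.ZH_nonneg_of_crossIntersecting` (and `ZG`, `ZT` via `ZH_le_ZG`, `ZG_le_ZT`);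
* `ZH_ofUpsets_nonneg_of_crossIntersecting` — for three arbitrary up-sets `U₁, U₂, U₃` two of which are cross-intersecting families, the (R2) functional
  of `ofUpsets U` is `≥ 0`; e.g. principal filters `↑w₁, ↑w₂, ↑w₃` with `w_i ∩ w_j ≠ ∅` for some `i ≠ j` (`ZH_ofUpsets_principal_nonneg`).
(The complementary principal case — pairwise disjoint generators — is the tight PRODUCT case `ZH = 0`, memo g25 §9 / g26 §8; not formalised here.)
This is the first infinite structural class beyond "a petal is empty" for which the conjectured partition lemma is a theorem in the tree.
-/

namespace Summit.CriticalPhenomena.PercolationContinuityZ3.Theorems.SunflowerPartition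

open Finset

/-- A rainbow triple takes every petal value. [this work] -/
theorem triP_ne_zero_petal : ∀ x y z v : Fin 5, triP x y z ≠ 0 → (v = 1 ∨ v = 2 ∨ v = 3) → (x = v ∨ y = v ∨ z = v) := by
  decide

variable {α : Type*} [Fintype α] [DecidableEq α]

/-- Two DISTINCT blocks of an ordered 3-partition are disjoint. [this work] -/
theorem parts_blocks_disjoint {q : Finset α × Finset α} (hq : q ∈ parts α) {B₁ B₂ : Finset α}
    (h1 : B₁ = q.1 ∨ B₁ = q.2 ∨ B₁ = (q.1 ∪ q.2)ᶜ) (h2 : B₂ = q.1 ∨ B₂ = q.2 ∨ B₂ = (q.1 ∪ q.2)ᶜ) (hne : B₁ ≠ B₂) :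
    Disjoint B₁ B₂ := by
  unfold parts at hq
  rw [mem_filter] at hq
  have d12 : Disjoint q.1 q.2 := hq.2
  have d13 : Disjoint q.1 (q.1 ∪ q.2)ᶜ := disjoint_compl_right.mono_left subset_union_left
  have d23 : Disjoint q.2 (q.1 ∪ q.2)ᶜ := disjoint_compl_right.mono_left subset_union_right
  rcases h1 with rfl | rfl | rfl <;> rcases h2 with rfl | rfl | rfl
  · exact absurd rfl hne
  · exact d12
  · exact d13
  · exact d12.symm
  · exact absurd rfl hne
  · exact d23
  · exact d13.symm
  · exact d23.symm
  · exact absurd rfl hne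

namespace Sunflower

variable (F : Sunflower α)

/-- In a partition with a rainbow label triple, some block carries any prescribed petal value. [this work] -/
theorem exists_block_of_triP (q : Finset α × Finset α) (v : Fin 5) (hv : v = 1 ∨ v = 2 ∨ v = 3)
    (h : triP (F.lab q.1) (F.lab q.2) (F.lab (q.1 ∪ q.2)ᶜ) ≠ 0) :
    ∃ B : Finset α, (B = q.1 ∨ B = q.2 ∨ B = (q.1 ∪ q.2)ᶜ) ∧ F.lab B = v := by
  rcases triP_ne_zero_petal _ _ _ v h hv with h1 | h2 | h3
  · exact ⟨q.1, Or.inl rfl, h1⟩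
  · exact ⟨q.2, Or.inr (Or.inl rfl), h2⟩
  · exact ⟨(q.1 ∪ q.2)ᶜ, Or.inr (Or.inr rfl), h3⟩

/-- **Cross-intersecting petals kill every rainbow partition.** If every member of the petal `C_i = V i ∖ A` meets every member of the petal `C_j`
(`i ≠ j`), then `Ntri = 0`. [this work] -/
theorem Ntri_eq_zero_of_crossIntersecting (i j : Fin 3) (hij : i ≠ j)
    (hx : ∀ S ∈ F.V i, S ∉ F.A → ∀ T ∈ F.V j, T ∉ F.A → (S ∩ T).Nonempty) : F.Ntri = 0 := by
  unfold Ntri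
  refine sum_eq_zero fun q hq => ?_
  by_contra hne
  have hvi : (⟨i.val + 1, by omega⟩ : Fin 5) = 1 ∨ (⟨i.val + 1, by omega⟩ : Fin 5) = 2 ∨ (⟨i.val + 1, by omega⟩ : Fin 5) = 3 := by
    fin_cases i <;> decide
  have hvj : (⟨j.val + 1, by omega⟩ : Fin 5) = 1 ∨ (⟨j.val + 1, by omega⟩ : Fin 5) = 2 ∨ (⟨j.val + 1, by omega⟩ : Fin 5) = 3 := by
    fin_cases j <;> decide
  obtain ⟨B₁, hB₁, hl₁⟩ := F.exists_block_of_triP q _ hvi hne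
  obtain ⟨B₂, hB₂, hl₂⟩ := F.exists_block_of_triP q _ hvj hne
  have hv₁ : (F.lab B₁).val = i.val + 1 := by rw [hl₁]
  have hv₂ : (F.lab B₂).val = j.val + 1 := by rw [hl₂]
  obtain ⟨m₁, a₁⟩ := F.mem_V_of_lab_val B₁ i hv₁
  obtain ⟨m₂, a₂⟩ := F.mem_V_of_lab_val B₂ j hv₂
  have hB : B₁ ≠ B₂ := by
    intro h
    rw [h] at hv₁
    have : i.val = j.val := by omega
    exact hij (Fin.ext this)
  have hd := parts_blocks_disjoint hq hB₁ hB₂ hB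
  obtain ⟨x, hx'⟩ := hx B₁ m₁ a₁ B₂ m₂ a₂
  rw [mem_inter] at hx'
  exact Finset.disjoint_left.1 hd hx'.1 hx'.2

/-- **The partition lemma for sunflowers with two cross-intersecting petals**: `0 ≤ ZH`. [this work] -/
theorem ZH_nonneg_of_crossIntersecting (i j : Fin 3) (hij : i ≠ j)
    (hx : ∀ S ∈ F.V i, S ∉ F.A → ∀ T ∈ F.V j, T ∉ F.A → (S ∩ T).Nonempty) : 0 ≤ F.ZH :=
  F.ZH_nonneg_of_Ntri_eq_zero (F.Ntri_eq_zero_of_crossIntersecting i j hij hx)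

/-- The `G`-row version. [this work] -/
theorem ZG_nonneg_of_crossIntersecting (i j : Fin 3) (hij : i ≠ j)
    (hx : ∀ S ∈ F.V i, S ∉ F.A → ∀ T ∈ F.V j, T ∉ F.A → (S ∩ T).Nonempty) : 0 ≤ F.ZG :=
  le_trans (F.ZH_nonneg_of_crossIntersecting i j hij hx) F.ZH_le_ZG

/-- The `T`-row (`γ`) version. [this work] -/
theorem ZT_nonneg_of_crossIntersecting (i j : Fin 3) (hij : i ≠ j)
    (hx : ∀ S ∈ F.V i, S ∉ F.A → ∀ T ∈ F.V j, T ∉ F.A → (S ∩ T).Nonempty) : 0 ≤ F.ZT :=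
  le_trans (F.ZG_nonneg_of_crossIntersecting i j hij hx) F.ZG_le_ZT

end Sunflower

/-! ## The θ-pullback of three up-sets, two of them cross-intersecting -/

omit [Fintype α] in
/-- A set of `V i` of the θ-pullback outside its kernel lies in `U i`. [this work] -/
theorem mem_U_of_mem_ofUpsets_V {U : Fin 3 → Finset (Finset α)} (hU : ∀ i, IsUpperSet (U i : Set (Finset α))) {i : Fin 3} {S : Finset α}
    (hS : S ∈ (ofUpsets U hU).V i) (hA : S ∉ (ofUpsets U hU).A) : S ∈ U i := by
  have hV : (ofUpsets U hU).V i = U i ∪ twoOf U := rfl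
  rw [hV, mem_union] at hS
  rcases hS with h | h
  · exact h
  · exfalso
    apply hA
    unfold Sunflower.A
    show S ∈ (U 0 ∪ twoOf U) ∩ (U 1 ∪ twoOf U)
    rw [mem_inter, mem_union, mem_union]
    exact ⟨Or.inr h, Or.inr h⟩

/-- **(R2) for three up-sets two of which are CROSS-INTERSECTING**: if every member of `U i` meets every member of `U j` (`i ≠ j`), the partition functional of
the θ-pullback sunflower is `≥ 0`. [this work] -/
theorem ZH_ofUpsets_nonneg_of_crossIntersecting (U : Fin 3 → Finset (Finset α)) (hU : ∀ i, IsUpperSet (U i : Set (Finset α)))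
    (i j : Fin 3) (hij : i ≠ j) (hx : ∀ S ∈ U i, ∀ T ∈ U j, (S ∩ T).Nonempty) : 0 ≤ (ofUpsets U hU).ZH :=
  (ofUpsets U hU).ZH_nonneg_of_crossIntersecting i j hij fun S hS hSA T hT hTA =>
    hx S (mem_U_of_mem_ofUpsets_V hU hS hSA) T (mem_U_of_mem_ofUpsets_V hU hT hTA)

/-- The principal filter `↑w = {S | w ⊆ S}` as a `Finset`. [this work] -/
def principal (w : Finset α) : Finset (Finset α) := univ.filter fun S => w ⊆ S

omit [DecidableEq α] in
/-- Membership in a principal filter. [this work] -/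
theorem mem_principal [DecidableEq α] {w S : Finset α} : S ∈ principal w ↔ w ⊆ S := by
  unfold principal; simp

omit [DecidableEq α] in
/-- Principal filters are up-sets. [this work] -/
theorem principal_upper [DecidableEq α] (w : Finset α) : IsUpperSet (principal w : Set (Finset α)) := by
  intro S T hST hS
  rw [Finset.mem_coe, mem_principal] at hS ⊢
  exact hS.trans hST

/-- **(R2) for PRINCIPAL triples with an intersecting pair of generators**: for `U i = ↑(w i)` with `w i ∩ w j ≠ ∅` for some `i ≠ j`, the partition
functional of the θ-pullback is `≥ 0`.  (Pairwise disjoint generators form the tight product case `ZH = 0`.) [this work] -/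
theorem ZH_ofUpsets_principal_nonneg (w : Fin 3 → Finset α) (i j : Fin 3) (hij : i ≠ j) (h : (w i ∩ w j).Nonempty) :
    0 ≤ (ofUpsets (fun k => principal (w k)) (fun k => principal_upper (w k))).ZH := by
  refine ZH_ofUpsets_nonneg_of_crossIntersecting _ _ i j hij fun S hS T hT => ?_
  rw [mem_principal] at hS hT
  exact h.mono (inter_subset_inter hS hT)

end Summit.CriticalPhenomena.PercolationContinuityZ3.Theorems.SunflowerPartition
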